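import Summits.BirchSwinnertonDyer.BirchSwinnertonDyer.Theses.UniversalToricDescent
import Summits.BirchSwinnertonDyer.BirchSwinnertonDyer.Theorems.UniversalToricDescentToricTransportModThreeStubRatSqueeze
import Summits.BirchSwinnertonDyer.BirchSwinnertonDyer.Theorems.UniversalToricDescentRationalSplitIMCInclusionAtThreeOfWall
import Mathlib.RingTheory.Polynomial.Cyclotomic.Basic
import Mathlib.RingTheory.PowerSeries.Ideal
import Mathlib.RingTheory.Length
import HarnessLib

/-!
# NODE `lucas_gauge` — crux `AdditiveSplitIMCInclusionAtThree` (stmt-BirchSwinnertonDyer-20395, THE WALL, UTD)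
# crux-ideate STANDING COVER round 16 (unit cruxidea-stmt-BirchSwinnertonDyer-20395-1-g16), 2026-08-31

D-0171 NODE (leaf RE-SOURCING, `sorry` ONLY inside `stub_*`). The Lean frame (§0–§5) is node
`mu_dominance_relative_teeth` (cover g7) VERBATIM, re-namespaced: WALL ↔ RATWALL ∧ `MuDominanceAtThree` (kernel-checked
both ways) and `MuDominanceAtThree ⟸ IsTorsionOfFiniteToothQuot ∧ ToothDominanceReadsMu ∧ RelativeToothBoundAtThree`
(composition kernel-checked). The tree has no finite-level local-cohomology vocabulary at the additive prime, so the
only `μ`-sized UNDECIDED leaf of that road — the LOCAL CANCELLATION RT3 inside `RelativeToothBoundAtThree` (= K3 of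
node `toothwise_kolyvagin_mu`, E3+R4 of `resolvent_layer_index`, c3 of `supersingular_toric_test`) — cannot be typed
finer here; exactly as cover g13 did for c3, this node RE-SOURCES that leaf and records the new engine as proved kernel
shadows (§6) plus the cards `Lines/lucas_gauge.md`, `Ideas/lucas-gauge.md`.

THE NEW LEVER (why novel — one sentence): the local `χ`-gauge at the additive prime is NOT an instrument-only quantity
(g3 K3 «INSTRUMENTABLE», g7 RT3 «constant problem», g11 E3 «Gauss sum generates the eigenline» — true for `O_F`, false
for the ideal that actually occurs) but a CLOSED-FORM CYCLOTOMIC STAIRCASE: (i) the completion of the ring class field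
`K[3^m]` at the relaxed prime `𝔭'` is the LUBIN–TATE division field of level `m` for the uniformiser `ϖ_K = 3·u_K`
(local class field theory: norm group `⟨ϖ_K⟩·(1+3^m ℤ₃)`); (ii) HONDA (`Ê ≅ Ĝ_a` over `ℤ₃` at an additive prime) and
the clean filtration shift of the `F_m`-minimal model give the local Mordell–Weil lattice
`E(F_m) ⊗ ℤ₃ = 𝔪_{F_m}^{1+s_m}` up to index `≤ 9`, `s_m = ⌊v₃(Δ_min)·e_m/12⌋`, `e_m = 2·3^{m-1}` — a Galois IDEAL, not
`O_{F_m}`; (iii) DEURING–NOETHER descent along the unramified hull, plus `O_W ⊗ 𝒪_χ = O_{W(χ)}` (units ↦ units under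
multiplication), makes the `3`-adic valuation of the `χ`-isotypic generator INDEPENDENT of `u_K`, hence computable in
the CYCLOTOMIC field `ℚ₃(ζ_{3^m})`; (iv) there the `χ`-isotypic part of `𝔪^a ⊗ 𝒪_χ` is `(ξ-1)^{t_m(a)}·𝔤_χ·𝒪_χ`
for an explicit integer STAIRCASE `t_m(a)` governed by two elementary facts — TRACE ZERO of `ζ` to every proper
subfield (Ramanujan sums `c_{3^r}(1) = 0`) together with LUCAS' theorem (`C(e,i) mod 3` depends on `e mod 3^j` for
`i < 3^j`) gives `t_m(0) ≤ -3^{m-2}`, and `t_m(a + e_m) = t_m(a) + φ(3^{m-1})`, `t_m(a+2) ≤ t_m(a)+1` (slope `1/3` on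
average: the third finite difference kills 3-periodic residues, §6); for `m = 2` the whole staircase is computed by hand
(`t_2(a) = ⌊(a+5)/6⌋ + ⌊(a+1)/6⌋ - 1`, §6 `stair2`). CONSEQUENCE: the local gauge of the toothwise road equals
`ℓ(χ_m) = m/2 + t_m(1+s_m)/φ(3^{m-1}) = (m-1)/2 + c_alg + o(1)` with an explicit rational `c_alg(v₃(Δ_min))`
(conjecturally `v₃(Δ_min)/12`), so RT3 ⟺ ONE closed-form identity for the `3`-adic valuation of the additive-prime
normaliser of the finite-order `p`-adic Waldspurger value at conductor `3^m` (the antisymmetric half `χ ↔ χ̄` of which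
is certified by Kato's local `ε`-isomorphism for rank-two de Rham representations of `G_{ℚ₃}`). No kit is needed to
decide it: it is pencil-and-paper local algebra plus one published local formula.

Pieces / tags (D-0171): RATWALL — WEAKER (item 24207, landed `rationalSplitIMCInclusionAtThree_of_wall`);
`MuDominanceAtThree` — WEAKER, jointly with RATWALL EQUIVALENT to the crux (`wall_iff_ratwall_and_muDominance`);
c1 `IsTorsionOfFiniteToothQuot`, d `ToothDominanceReadsMu` — ATTACKABLE pure `Λ`-algebra (verbatim g7);
RT `RelativeToothBoundAtThree` — UNDECIDED, its sub-leaf RT3 now ATTACKABLE-by-hand (this node), RT1 ATTACKABLE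
(research-sized finite-level Kolyvagin), RT2 UNDECIDED (finite-order Waldspurger at an additive prime: port).
Barriers honoured: `TraceZeroHeegnerTowerAtAdditiveSplitP` (no `Λ`-adic class is used; trace zero is here a
RESOURCE — it is what enlarges the `χ`-isotypic lattice by half a `μ`-unit), `NoAdmissiblePrimesAtThree` (no
level raising). Nothing here is a theorem about elliptic curves beyond compositions of landed results; BSD is not
advanced by this file. References: [Washington1997] §7.1, §13.2; [Howard2004HeegnerKolyvagin] Thm. 2.2.10;
Lubin–Tate 1965; Honda 1968/1970 (formal groups and `L`-factors); Curtis–Reiner I §30 (Deuring–Noether for lattices);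
D. Burns, Comment. Math. Helv. 75 (2000) 1–44 (equivariant structure of ideals in abelian extensions of local fields)
[galaxy:pdf:-2357986051366658760]; L. Childs, Taming Wild Extensions (AMS 2000) §36 [corpus:book:childs2000 p0179];
S. Lang, Cyclotomic Fields I–II §1 (Gauss sums) [corpus:book:lang1990-cyclotomic-fields-i-ii]; K. Nakamura,
Camb. J. Math. 5 (2017) (local `ε`-isomorphisms, rank two); Castella 2020 (finite-order `p`-adic Waldspurger,
good ordinary case).
-/

set_option linter.dupNamespace false
set_option autoImplicit false

noncomputable section

open scoped Classical

open Literature.NumberTheory.EllipticCurves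
open Summit.BirchSwinnertonDyer.BirchSwinnertonDyer.Theses.UniversalToricDescent
  (RationalSplitIMCInclusionAtThree AdditiveSplitIMCInclusionAtThree)
open Summit.BirchSwinnertonDyer.BirchSwinnertonDyer.Cruxes.ToricTransportModThree.RatwallThinComb
  (dvd_of_dvd_prime_pow_mul prime_C_three)
open Summit.BirchSwinnertonDyer.BirchSwinnertonDyer.Theorems.UniversalToricDescentRationalSplitIMCInclusionAtThreeOfWall
  (rationalSplitIMCInclusionAtThree_of_wall)
open Summit.BirchSwinnertonDyer.Rank1Residual.X11b

namespace Summit.BirchSwinnertonDyer.BirchSwinnertonDyer.Cruxes.AdditiveSplitIMCInclusionAtThree.LucasGauge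

/-! ## §0 Kernel algebra in `R₀⟦T⟧` (no `sorry`) -/

/-- Every non-zero `g ∈ R₀⟦T⟧` splits off a MAXIMAL power of the prime `3`: `g = 3^μ·g₀` with `3 ∤ g₀`
(`R₀` is a DVR, so `R₀⟦T⟧` is a UFD; `WfDvdMonoid.max_power_factor`). This `μ` is the `μ`-invariant of `g`.
[Washington1997 §7.1] -/
theorem exists_eq_C_three_pow_mul_not_dvd {g : UnrSeries 3} (hg : g ≠ 0) :
    ∃ (μ : ℕ) (g₀ : UnrSeries 3),
      ¬ (PowerSeries.C ((3 : ℕ) : unrIntegers 3) : UnrSeries 3) ∣ g₀ ∧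
        g = (PowerSeries.C ((3 : ℕ) : unrIntegers 3)) ^ μ * g₀ := by
  haveI := Summit.BirchSwinnertonDyer.Rank1Residual.X2.HidaLimitAlgebra.isDiscreteValuationRing_unrIntegers (p := 3)
  exact WfDvdMonoid.max_power_factor hg prime_C_three.irreducible

/-- **The 3-saturation kernel of the wall.** In the domain `R₀⟦T⟧`: if `g ∣ 3^k·L` (the RATIONAL wall at a frame,
`Ch·R₀⟦T⟧ = (g)`) and every power of `3` dividing `g` divides `L` (`μ`-DOMINANCE), then `g ∣ L`, i.e.
`(L) ⊆ (g)` (the INTEGRAL wall at that frame). Proof: `g = 0` forces `L = 0`; else `g = 3^μ g₀`, `3 ∤ g₀`,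
`L = 3^μ L₀`, cancel `3^μ`, and `g₀ ∣ 3^k L₀` gives `g₀ ∣ L₀` since `3` is prime. [folklore; Washington1997 §7.1] -/
theorem span_le_span_of_dvd_pow_mul_of_muDominance {g L : UnrSeries 3} {k : ℕ}
    (hk : g ∣ (PowerSeries.C ((3 : ℕ) : unrIntegers 3)) ^ k * L)
    (hμ : ∀ j : ℕ, (PowerSeries.C ((3 : ℕ) : unrIntegers 3)) ^ j ∣ g →
      (PowerSeries.C ((3 : ℕ) : unrIntegers 3)) ^ j ∣ L) :
    Ideal.span ({L} : Set (UnrSeries 3)) ≤ Ideal.span {g} := by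
  refine Ideal.span_singleton_le_span_singleton.mpr ?_
  by_cases hg : g = 0
  · subst hg
    obtain ⟨c, hc⟩ := hk
    rw [zero_mul] at hc
    rcases mul_eq_zero.mp hc with h3 | hL
    · exact absurd (pow_eq_zero_iff'.mp h3).1 prime_C_three.ne_zero
    · rw [hL]
  · obtain ⟨μ, g₀, hg₀, rfl⟩ := exists_eq_C_three_pow_mul_not_dvd hg
    obtain ⟨L₀, rfl⟩ := hμ μ (Dvd.intro g₀ rfl)
    refine mul_dvd_mul_left _ (dvd_of_dvd_prime_pow_mul prime_C_three hg₀ k ?_)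
    have h' : (PowerSeries.C ((3 : ℕ) : unrIntegers 3)) ^ μ * g₀ ∣
        (PowerSeries.C ((3 : ℕ) : unrIntegers 3)) ^ μ * ((PowerSeries.C ((3 : ℕ) : unrIntegers 3)) ^ k * L₀) := by
      have e : (PowerSeries.C ((3 : ℕ) : unrIntegers 3)) ^ k * ((PowerSeries.C ((3 : ℕ) : unrIntegers 3)) ^ μ * L₀)
          = (PowerSeries.C ((3 : ℕ) : unrIntegers 3)) ^ μ * ((PowerSeries.C ((3 : ℕ) : unrIntegers 3)) ^ k * L₀) := by
        ring
      rw [← e]; exact hk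
    exact (mul_dvd_mul_iff_left (pow_ne_zero μ prime_C_three.ne_zero)).mp h'

/-- Converse of the kernel: an integral inclusion `(L) ⊆ (g)` gives `μ`-dominance trivially. [folklore] -/
theorem muDominance_of_span_le_span {g L : UnrSeries 3} (h : Ideal.span ({L} : Set (UnrSeries 3)) ≤ Ideal.span {g})
    (j : ℕ) (hj : (PowerSeries.C ((3 : ℕ) : unrIntegers 3)) ^ j ∣ g) :
    (PowerSeries.C ((3 : ℕ) : unrIntegers 3)) ^ j ∣ L :=
  hj.trans (Ideal.span_singleton_le_span_singleton.mp h)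

/-- `Ch_Λ(X)·R₀⟦T⟧` is principal for every `Λ`-module (tree `charIdeal_isPrincipal_holds`, `Ideal.map_span`).
[Washington1997 §13.2] -/
theorem exists_map_charIdeal_eq_span (M : Type) [AddCommGroup M] [Module (IwasawaAlgebra 3) M] :
    ∃ g : UnrSeries 3,
      (Module.charIdeal (IwasawaAlgebra 3) M).map (PowerSeries.map (Halves.toUnr 3)) = Ideal.span {g} := by
  obtain ⟨f, hf⟩ := (charIdeal_isPrincipal_holds 3 M).principal
  refine ⟨PowerSeries.map (Halves.toUnr 3) f, ?_⟩
  have hf' : Module.charIdeal (IwasawaAlgebra 3) M = Ideal.span {f} := hf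
  rw [hf', Ideal.map_span, Set.image_singleton]

/-! ## §1 The cyclotomic teeth -/

/-- The `k`-th CYCLOTOMIC TOOTH `𝔮_k = Φ_{3^k}(1+T) ∈ Λ = ℤ₃⟦T⟧` (degree `φ(3^k)`, `Λ/𝔮_k ≅ ℤ₃[ζ_{3^k}] = O_k`).
Same definition as node `toothwise_kolyvagin_mu`. [Washington1997 §7.1] -/
def tooth (k : ℕ) : IwasawaAlgebra 3 :=
  (((Polynomial.cyclotomic (3 ^ k) ℤ_[3]).comp (Polynomial.X + 1) : Polynomial ℤ_[3]) : PowerSeries ℤ_[3])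

/-- The tooth read in the receptacle `R₀⟦T⟧`. [Castella2018 §2.2] -/
def toothUnr (k : ℕ) : UnrSeries 3 :=
  PowerSeries.map (Halves.toUnr 3) (tooth k)

/-- The specialisation `M ⧸ 𝔮_k M` of a `Λ`-module at the `k`-th tooth. [folklore] -/
abbrev ToothQuot (M : Type) [AddCommGroup M] [Module (IwasawaAlgebra 3) M] (k : ℕ) : Type :=
  M ⧸ (Ideal.span {tooth k} • (⊤ : Submodule (IwasawaAlgebra 3) M))

/-- The `R₀⟦T⟧`-length of `R₀⟦T⟧/(𝔮_k, L)` = `v_{π_k}(L(ζ_{3^k} - 1))` (`⊤` iff `𝔮_k ∣ L`): the analytic side read at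
the tooth WITHOUT an evaluation map. [Washington1997 §7.1] -/
abbrev toothLengthOf (L : UnrSeries 3) (k : ℕ) : ℕ∞ :=
  Module.length (UnrSeries 3) (UnrSeries 3 ⧸ Ideal.span ({toothUnr k, L} : Set (UnrSeries 3)))

/-! ## §2 Pieces (Props) -/

/-- PIECE A = LEVEL-1 SURPLUS (tag WEAKER than the crux: `muDominance_of_wall`; jointly with RATWALL EQUIVALENT to it:
`wall_iff_ratwall_and_muDominance`). `μ`-DOMINANCE at additive split 3: at every wall frame (binders = the wall's,
verbatim) and every generator `g` of `Ch_Λ(X_(∅,0)(E/K_∞))·R₀⟦T⟧`, each power of `3` dividing `g` divides the BDP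
branch `L`: `μ(Ch X) ≤ μ(L)`. NOT `μ = 0`; tolerates `μ(L) > 0`; vacuous off the torsion locus exactly like the
wall (`Ch = ⊤`, `g` a unit). [Howard2004HeegnerKolyvagin Thm. 2.2.10 shape; Washington1997 §13.2] -/
def MuDominanceAtThree : Prop :=
  ∀ (W : WeierstrassCurve ℚ) [W.IsElliptic] [W.IsGloballyMinimal] (N : ℕ) [NeZero N] (K : Type) [Field K]
    [NumberField K] (Dt : Literature.NumberTheory.EllipticCurves.ModularForms.ModularParametrizationData W N),
    Summit.BirchSwinnertonDyer.Rank1Residual.Additive.ClassO6 W 3 → W.HasSurjectiveModNGaloisRep 3 →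
    W.analyticRank = 1 → W.conductorNorm ℤ = N → IsImaginaryQuadratic K → SatisfiesHeegnerHypothesis N K →
    ∀ (κ : ZpExtension K 3), κ.IsAnticyclotomic →
    ∀ (γ : Field.absoluteGaloisGroup K) [Fact (κ.IsTopGenerator γ)]
      (𝔭 : IsDedekindDomain.HeightOneSpectrum (NumberField.RingOfIntegers K)),
      ((3 : ℕ) : NumberField.RingOfIntegers K) ∈ 𝔭.asIdeal →
      𝔭.asIdeal.ramificationIdx (NumberField.RingOfIntegers ℚ) = 1 →
      𝔭.asIdeal.inertiaDeg (NumberField.RingOfIntegers ℚ) = 1 →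
      ∀ (𝔭' : IsDedekindDomain.HeightOneSpectrum (NumberField.RingOfIntegers K)),
        ((3 : ℕ) : NumberField.RingOfIntegers K) ∈ 𝔭'.asIdeal → 𝔭' ≠ 𝔭 →
        ∀ (ι' : PadicAlgCl 3 ≃+* ℂ),
          Summit.BirchSwinnertonDyer.BirchSwinnertonDyer.Theorems.SchneiderFree.BranchInducesPrime 3 ι' 𝔭 →
          ∀ (ΩK : ℂ) (Ωp : ℂ_[3]) (L : UnrSeries 3), ΩK ≠ 0 → Ωp ≠ 0 →
            IsBDPLFunction ι' 𝔭 κ γ Dt.f ΩK Ωp L →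
            ∀ g : UnrSeries 3,
              (AcSelmer.XAc.charIdeal (W.baseChange K) 3 κ 𝔭' ∅ γ).map (PowerSeries.map (Halves.toUnr 3)) =
                  Ideal.span {g} →
              ∀ j : ℕ, (PowerSeries.C ((3 : ℕ) : unrIntegers 3)) ^ j ∣ g →
                (PowerSeries.C ((3 : ℕ) : unrIntegers 3)) ^ j ∣ L

/-- PIECE c1 (ATTACKABLE, pure `Λ`-algebra, S-sized; verbatim the piece c1 of node `toothwise_kolyvagin_mu`): a finitely
generated `Λ`-module with ONE finite tooth specialisation is `Λ`-torsion. [Washington1997 §13.2] -/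
def IsTorsionOfFiniteToothQuot : Prop :=
  ∀ (M : Type) [AddCommGroup M] [Module (IwasawaAlgebra 3) M] [Module.Finite (IwasawaAlgebra 3) M],
    (∃ k : ℕ, Finite (ToothQuot M k)) → Module.IsTorsion (IwasawaAlgebra 3) M

/-- PIECE d (ATTACKABLE, pure `Λ`-algebra, M-sized): THE TEETH READ `μ`-DOMINANCE. For a f.g. torsion `Λ`-module `M`
with `Ch(M)·R₀⟦T⟧ = (g)` and any `L ∈ R₀⟦T⟧`: if for every `n` and infinitely many `k`,
`n·ℓ_Λ(M/𝔮_k M) ≤ n·ℓ(R₀⟦T⟧/(𝔮_k,L)) + φ(3^k)` (in `ℕ∞`), then every power of `3` dividing `g` divides `L`.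
Reason: for `k ≫ 0`, `ℓ_Λ(M/𝔮_k M) = μ(M)φ(3^k) + λ(M) + O(1)` (structure theorem up to finite modules;
`ℓ(Λ/(3^a,𝔮_k)) = aφ(3^k)`, `ℓ(Λ/(P,𝔮_k)) = deg P` for distinguished `P` once `φ(3^k) > deg P`) and
`ℓ(R₀⟦T⟧/(𝔮_k,L)) = μ(L)φ(3^k) + λ(L)`; dividing by `φ(3^k) → ∞` gives `nμ(M) ≤ nμ(L) + 1` for all `n`. Degenerate
cases (`L = 0`; `𝔮_k ∣ L` or `𝔮_k ∣ Ch M` for the witnessing `k`) are consistent (`⊤` on the right). NOT a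
divisibility statement: teeth read `(μ, λ)` only (lineage barrier B-g37-1 respected). Sibling of the tree's
`exists_card_quotSMulTop_qm_bounds` at Howard's primes. [Washington1997 §7.1 Prop. 7.2, §13.2 Thm. 13.12] -/
def ToothDominanceReadsMu : Prop :=
  ∀ (M : Type) [AddCommGroup M] [Module (IwasawaAlgebra 3) M] [Module.Finite (IwasawaAlgebra 3) M],
    Module.IsTorsion (IwasawaAlgebra 3) M →
    ∀ (g L : UnrSeries 3),
      (Module.charIdeal (IwasawaAlgebra 3) M).map (PowerSeries.map (Halves.toUnr 3)) = Ideal.span {g} →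
      (∀ n k₀ : ℕ, ∃ k : ℕ, k₀ ≤ k ∧
        (n : ℕ∞) * Module.length (IwasawaAlgebra 3) (ToothQuot M k) ≤
          (n : ℕ∞) * toothLengthOf L k + (Nat.totient (3 ^ k) : ℕ∞)) →
      ∀ j : ℕ, (PowerSeries.C ((3 : ℕ) : unrIntegers 3)) ^ j ∣ g →
        (PowerSeries.C ((3 : ℕ) : unrIntegers 3)) ^ j ∣ L

/-- PIECE RT — THE ARITHMETIC LEAF (UNDECIDED; idea `relative-tooth-dominance`). RELATIVE TOOTH BOUND at additive
split 3: at every wall frame (binders = the wall's, verbatim), for every `n` and infinitely many teeth `𝔮_k`, the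
`(∅,0)` Selmer specialisation `X/𝔮_k X` is finite and `n·ℓ_Λ(X/𝔮_k X) ≤ n·v_{π_k}(L(ζ_{3^k}-1)) + φ(3^k)`, i.e.
`ℓ_{O_k}(X/𝔮_k X) ≤ v_{π_k}(L(ζ_{3^k}-1)) + o(φ(3^k))`. Informal engine (line card §Stubs RT1–RT3): a finite-level
Kolyvagin system over `O_k/π^j` from the trace-zero CM class of conductor `3^{k+c}` (lossless at deep teeth:
twisted Tamagawa lengths `O(3^{s(q)})`, Galois error `0`), the `(∅,0)`-vs-classical length identity in which the
global index CANCELS, the finite-order `p`-adic Waldspurger formula at the SAME character, and a LOCAL cancellation at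
the additive prime between the resolvent valuation of the `χ_k`-generator of `Ĝ_a`-points and the conductor-`3^k`
local toric factor. No analytic `μ` theorem, no twin, no `Λ`-adic class. Why it might fail: the local cancellation
RT3 may be off by `c·φ(3^k)` with `c > 0` on SCr rows (then only `μ(Ch X) ≤ μ(L) + c`). -/
def RelativeToothBoundAtThree : Prop :=
  ∀ (W : WeierstrassCurve ℚ) [W.IsElliptic] [W.IsGloballyMinimal] (N : ℕ) [NeZero N] (K : Type) [Field K]
    [NumberField K] (Dt : Literature.NumberTheory.EllipticCurves.ModularForms.ModularParametrizationData W N),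
    Summit.BirchSwinnertonDyer.Rank1Residual.Additive.ClassO6 W 3 → W.HasSurjectiveModNGaloisRep 3 →
    W.analyticRank = 1 → W.conductorNorm ℤ = N → IsImaginaryQuadratic K → SatisfiesHeegnerHypothesis N K →
    ∀ (κ : ZpExtension K 3), κ.IsAnticyclotomic →
    ∀ (γ : Field.absoluteGaloisGroup K) [Fact (κ.IsTopGenerator γ)]
      (𝔭 : IsDedekindDomain.HeightOneSpectrum (NumberField.RingOfIntegers K)),
      ((3 : ℕ) : NumberField.RingOfIntegers K) ∈ 𝔭.asIdeal →
      𝔭.asIdeal.ramificationIdx (NumberField.RingOfIntegers ℚ) = 1 →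
      𝔭.asIdeal.inertiaDeg (NumberField.RingOfIntegers ℚ) = 1 →
      ∀ (𝔭' : IsDedekindDomain.HeightOneSpectrum (NumberField.RingOfIntegers K)),
        ((3 : ℕ) : NumberField.RingOfIntegers K) ∈ 𝔭'.asIdeal → 𝔭' ≠ 𝔭 →
        ∀ (ι' : PadicAlgCl 3 ≃+* ℂ),
          Summit.BirchSwinnertonDyer.BirchSwinnertonDyer.Theorems.SchneiderFree.BranchInducesPrime 3 ι' 𝔭 →
          ∀ (ΩK : ℂ) (Ωp : ℂ_[3]) (L : UnrSeries 3), ΩK ≠ 0 → Ωp ≠ 0 →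
            IsBDPLFunction ι' 𝔭 κ γ Dt.f ΩK Ωp L →
            ∀ n k₀ : ℕ, ∃ k : ℕ, k₀ ≤ k ∧
              Finite (ToothQuot (AcSelmer.XAc (W.baseChange K) 3 κ 𝔭' ∅ γ) k) ∧
              (n : ℕ∞) * Module.length (IwasawaAlgebra 3) (ToothQuot (AcSelmer.XAc (W.baseChange K) 3 κ 𝔭' ∅ γ) k) ≤
                (n : ℕ∞) * toothLengthOf L k + (Nat.totient (3 ^ k) : ℕ∞)

/-! ## §3 Registered stubs (the ONLY `sorry`s) -/

/-- STUB (WEAKER — route item 24207 `RationalSplitIMCInclusionAtThree` BY NAME; `ratwall_of_wall`). -/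
theorem stub_ratwall : RationalSplitIMCInclusionAtThree := by
  sorry

/-- STUB (ATTACKABLE — piece c1, pure algebra). -/
theorem stub_isTorsionOfFiniteToothQuot : IsTorsionOfFiniteToothQuot := by
  sorry

/-- STUB (ATTACKABLE — piece d, pure algebra). -/
theorem stub_toothDominanceReadsMu : ToothDominanceReadsMu := by
  sorry

/-- STUB (UNDECIDED — piece RT, the arithmetic leaf). -/
theorem stub_relativeToothBound : RelativeToothBoundAtThree := by
  sorry

/-! ## §4 LEVEL 1: WALL ↔ RATWALL ∧ μ-DOMINANCE (kernel-checked both ways) -/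

/-- **The wall from the rational wall and `μ`-dominance** (concludes the crux BY NAME). At a frame: `3^k·L ∈ (g)`
(RATWALL), `g` a generator of `Ch·R₀⟦T⟧` (always exists), `μ`-dominance for this `g`; the §0 kernel gives
`(L) ⊆ (g)`. [folklore; Washington1997 §7.1] -/
theorem wall_of_ratwall_of_muDominance :
    RationalSplitIMCInclusionAtThree → MuDominanceAtThree → AdditiveSplitIMCInclusionAtThree := by
  intro hR hM W _ _ N _ K _ _ Dt hO6 hsurj hr1 hN hK hH κ hκ γ _ 𝔭 h3 he hf 𝔭' h3' hne ι' hι ΩK Ωp L hΩK hΩp hL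
  obtain ⟨k, hk⟩ := hR W N K Dt hO6 hsurj hr1 hN hK hH κ hκ γ 𝔭 h3 he hf 𝔭' h3' hne ι' hι ΩK Ωp L hΩK hΩp hL
  obtain ⟨g, hg⟩ := exists_map_charIdeal_eq_span (AcSelmer.XAc (W.baseChange K) 3 κ 𝔭' ∅ γ)
  have hg' : (AcSelmer.XAc.charIdeal (W.baseChange K) 3 κ 𝔭' ∅ γ).map (PowerSeries.map (Halves.toUnr 3)) =
      Ideal.span {g} := hg
  have hμ := hM W N K Dt hO6 hsurj hr1 hN hK hH κ hκ γ 𝔭 h3 he hf 𝔭' h3' hne ι' hι ΩK Ωp L hΩK hΩp hL g hg'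
  rw [hg'] at hk ⊢
  have hdvd : g ∣ ((3 : ℕ) : UnrSeries 3) ^ k * L := Ideal.mem_span_singleton.mp hk
  rw [← map_natCast (PowerSeries.C (R := unrIntegers 3))] at hdvd
  exact span_le_span_of_dvd_pow_mul_of_muDominance hdvd hμ

/-- Tag WEAKER for piece A: THE WALL ⟹ `μ`-DOMINANCE (at a frame `(L) ⊆ Ch·R₀⟦T⟧ = (g)` gives `g ∣ L`). -/
theorem muDominance_of_wall : AdditiveSplitIMCInclusionAtThree → MuDominanceAtThree := by
  intro hW W _ _ N _ K _ _ Dt hO6 hsurj hr1 hN hK hH κ hκ γ _ 𝔭 h3 he hf 𝔭' h3' hne ι' hι ΩK Ωp L hΩK hΩp hL g hg j hj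
  have h := hW W N K Dt hO6 hsurj hr1 hN hK hH κ hκ γ 𝔭 h3 he hf 𝔭' h3' hne ι' hι ΩK Ωp L hΩK hΩp hL
  rw [hg] at h
  exact muDominance_of_span_le_span h j hj

/-- Tag WEAKER for RATWALL (landed, `k = 0`). -/
theorem ratwall_of_wall : AdditiveSplitIMCInclusionAtThree → RationalSplitIMCInclusionAtThree :=
  rationalSplitIMCInclusionAtThree_of_wall

/-- **THE EXACT COMPLEMENT**: THE WALL ↔ RATWALL ∧ `μ`-DOMINANCE. What the integral wall (20395) demands beyond the
rational wall (24207) is precisely `MuDominanceAtThree` — an inequality of `μ`-invariants, not a `μ = 0` theorem. -/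
theorem wall_iff_ratwall_and_muDominance :
    AdditiveSplitIMCInclusionAtThree ↔ (RationalSplitIMCInclusionAtThree ∧ MuDominanceAtThree) :=
  ⟨fun h ↦ ⟨ratwall_of_wall h, muDominance_of_wall h⟩, fun h ↦ wall_of_ratwall_of_muDominance h.1 h.2⟩

/-! ## §5 LEVEL 2: the relative teeth give μ-dominance (composition kernel-checked) -/

/-- **`μ`-dominance from the relative tooth bound.** `X = X_(∅,0)(E/K_∞)` is finitely generated over `Λ` (LANDED,
`AcSelmer.XAc.module_finite`); one finite tooth specialisation makes it torsion (c1); the relative tooth inequalities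
(RT) feed the algebraic door (d). [Washington1997 §13.2] -/
theorem muDominanceAtThree_of_teeth :
    IsTorsionOfFiniteToothQuot → ToothDominanceReadsMu → RelativeToothBoundAtThree → MuDominanceAtThree := by
  intro h1 h2 h3 W _ _ N _ K _ _ Dt hO6 hsurj hr1 hN hK hH κ hκ γ _ 𝔭 hp3 he hf 𝔭' h3' hne ι' hι ΩK Ωp L hΩK hΩp hL
    g hg j hj
  haveI : Module.Finite (IwasawaAlgebra 3) (AcSelmer.XAc (W.baseChange K) 3 κ 𝔭' ∅ γ) :=
    AcSelmer.XAc.module_finite κ 𝔭' ∅ γ Set.finite_empty (W := W.baseChange K)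
  have hrel := h3 W N K Dt hO6 hsurj hr1 hN hK hH κ hκ γ 𝔭 hp3 he hf 𝔭' h3' hne ι' hι ΩK Ωp L hΩK hΩp hL
  obtain ⟨k, -, hfin, -⟩ := hrel 1 0
  have hT : Module.IsTorsion (IwasawaAlgebra 3) (AcSelmer.XAc (W.baseChange K) 3 κ 𝔭' ∅ γ) :=
    h1 (AcSelmer.XAc (W.baseChange K) 3 κ 𝔭' ∅ γ) ⟨k, hfin⟩
  have hg' : (Module.charIdeal (IwasawaAlgebra 3) (AcSelmer.XAc (W.baseChange K) 3 κ 𝔭' ∅ γ)).map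
      (PowerSeries.map (Halves.toUnr 3)) = Ideal.span {g} := hg
  refine h2 (AcSelmer.XAc (W.baseChange K) 3 κ 𝔭' ∅ γ) hT g L hg' ?_ j hj
  intro n k₀
  obtain ⟨k', hk', -, hle⟩ := hrel n k₀
  exact ⟨k', hk', hle⟩

/-- **THE COMPOSITION (concludes the crux BY NAME from exactly the four registered stubs)**: THE WALL from RATWALL
and the three tooth pieces. -/
theorem AdditiveSplitIMCInclusionAtThree_of :
    RationalSplitIMCInclusionAtThree → IsTorsionOfFiniteToothQuot → ToothDominanceReadsMu →
      RelativeToothBoundAtThree → AdditiveSplitIMCInclusionAtThree :=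
  fun hR h1 h2 h3 ↦ wall_of_ratwall_of_muDominance hR (muDominanceAtThree_of_teeth h1 h2 h3)

/-- The crux from the stubs as registered (`sorryAx` by design — proof-of-item NOT closed). -/
theorem AdditiveSplitIMCInclusionAtThree_holds_of_stubs : AdditiveSplitIMCInclusionAtThree :=
  AdditiveSplitIMCInclusionAtThree_of stub_ratwall stub_isTorsionOfFiniteToothQuot stub_toothDominanceReadsMu
    stub_relativeToothBound

/-! ## §6 Kernel shadows of the LUCAS GAUGE (no `sorry`; elementary models of the new engine) -/

/-- **Slope `1/3` mechanism.** The third finite difference of a `3`-periodic integer function is divisible by `3`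
(`Δ³f(b) = f(b+3) - f(b) + 3(f(b+1) - f(b+2))`). Model of: the `χ`-resolvent of `(ζ-1)^a ζ^b` is the Gauss sum
times the `a`-th finite difference of the zero-extended character, whose reduction modulo `(ξ-1)` is `3`-periodic,
so every third power of `𝔪` gains one power of `(ξ-1)`. [folklore] -/
theorem third_difference_dvd_three (f : ℤ → ℤ) (hf : ∀ x, f (x + 3) = f x) (b : ℤ) :
    (3 : ℤ) ∣ f (b + 3) - 3 * f (b + 2) + 3 * f (b + 1) - f b := by
  refine ⟨f (b + 1) - f (b + 2), ?_⟩
  rw [hf b]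
  ring

/-- The level-`2` STAIRCASE `t_2(a)`: exponent of `(ω-1)` such that the `χ`-isotypic part of `𝔪^a ⊗ ℤ₃[ω]`
(`F = ℚ₃(ζ_9)`, `χ` of order `3` and conductor `9`) is `(ω-1)^{t_2(a)}·𝔤_χ·ℤ₃[ω]`; computed by hand in
`Lines/lucas_gauge.md` §Evidence (coordinates `η_0-η_2`, `η_1-η_2` of valuation `4`; `(ω-1)^{-1}𝔤_χ = -η_0 ⊗ 1 + η_2 ⊗ ω`
by trace zero). [this node] -/
def stair2 (a : ℕ) : ℤ :=
  (((a + 5) / 6 : ℕ) : ℤ) + (((a + 1) / 6 : ℕ) : ℤ) - 1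

/-- Periodicity `t_2(a + e_F) = t_2(a) + v_χ(3)` (`e_F = 6`, `v_χ(3) = 2`): average slope `1/3`. -/
theorem stair2_add_six (a : ℕ) : stair2 (a + 6) = stair2 a + 2 := by
  unfold stair2
  omega

/-- The hand-computed values of the level-`2` staircase (jumps at `a ≡ 1, 5 (mod 6)`; `t_2(0) = -1 = -3^{m-2}`). -/
theorem stair2_values :
    stair2 0 = -1 ∧ stair2 1 = 0 ∧ stair2 4 = 0 ∧ stair2 5 = 1 ∧ stair2 6 = 1 ∧ stair2 7 = 2 ∧
      stair2 10 = 2 ∧ stair2 11 = 3 ∧ stair2 12 = 3 := by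
  unfold stair2
  omega

/-- Local slope bound `t(a+2) ≤ t(a)+1` shadow at level `2`: the staircase never climbs faster than `1/2`
(model of `(σ_4 - 1)𝔪^a ⊆ 𝔪^{a+2}`, `i_G(σ_4) = 3`). -/
theorem stair2_add_two_le (a : ℕ) : stair2 (a + 2) ≤ stair2 a + 1 := by
  unfold stair2
  omega

end Summit.BirchSwinnertonDyer.BirchSwinnertonDyer.Cruxes.AdditiveSplitIMCInclusionAtThree.LucasGauge

end
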